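import Literature.AnabelianGeometry.EtaleTheta.ThetaCoversTempered
import Mathlib.Tactic.Group

/-!
# Regression test for [EtTh] Rmk 2.6.1 / Rmk 2.1.1 (RQ7 audit, abc-iut-L6-t23)

Over the interface `ThetaCovers.TemperedCoverData` (seat abc-iut-L2-t2) we PROVE that
`Aut_K(C̲) = N_{Π^tp_C}(Π^tp_{C̲})/Π^tp_{C̲}` is trivial: `autK (tp PiCu)` is a subsingleton.  This is the
content of Remark 2.1.1 ("`C̲ → C` fails to be Galois") transported to the tempered group by density of
`Π^tp_C ↪ Π_C`, and it is the `C̲`-clause of Remark 2.6.1 ("`Aut_K(C̲^log) = {1}`"), unconditionally in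
`μ_l ⊆ K`.  [cite: MochizukiEtTh2009, Rmk 2.6.1 p.40]
-/

namespace Literature.AnabelianGeometry.EtaleTheta

namespace ThetaCovers

namespace TemperedCoverData

universe u

variable {l : ℕ} (T : TemperedCoverData.{u} l)

/-- `Π_{C̲} := Π_{C̲̲} · Δ̄_Θ` is the `H'` of the construction of `Π_{C̲̲}` (Def 2.3): in particular it is
of type `(1, l-tors)±` and contains an inversion. [cite: MochizukiEtTh2009, Def 2.3 p.38] -/
theorem PiCu_spec : ∃ (H' : Subgroup T.PiC) (ι : T.PiC),
    T.IsTypeLTorsPm H' ∧ T.IsInversion H' ι ∧ T.PiCu = H' := by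
  obtain ⟨H', E, S, ι, hH', hι, -, hE, hS, hdef⟩ := T.isTypeLTorsThetaPm.out
  refine ⟨H', ι, hH', hι, ?_⟩
  haveI := T.barTheta_normal
  have hT := hH'.inf_isTypeLTors
  have hSle : S ≤ H' ⊓ T.PiX :=
    hS.le.trans (sup_le hT.Dx_le (T.barKer_le_barTheta.trans hT.barTheta_le))
  have hEle : E ≤ H' ⊓ T.PiX := hE.le.trans inf_le_left
  have hιH' : ι ∈ H' := hι.mem
  have hCu : T.PiCu = ((S ⊔ E) ⊔ Subgroup.zpowers ι) ⊔ T.barTheta := by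
    unfold PiCu; rw [hdef]
  apply le_antisymm
  · rw [hCu]
    refine sup_le (sup_le (sup_le (hSle.trans inf_le_left) (hEle.trans inf_le_left)) ?_)
      (hT.barTheta_le.trans inf_le_left)
    rw [Subgroup.zpowers_le]
    exact hιH'
  · -- `H' ⊓ Π_X ≤ Π_{C̲}`: write `h = s · (s⁻¹ h)` with `s ∈ S`, `s⁻¹ h ∈ E · Δ̄_Θ`.
    have hH : H' ⊓ T.PiX ≤ T.PiCu := by
      intro h hh
      obtain ⟨⟨s, hs⟩, hsh⟩ := hS.surj (T.aug h)
      have hsh : T.aug s = T.aug h := hsh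
      have hy : s⁻¹ * h ∈ E ⊔ T.barTheta := by
        rw [hE.sup_eq]
        refine ⟨Subgroup.mul_mem _ (Subgroup.inv_mem _ (hSle hs)) hh, ?_⟩
        change s⁻¹ * h ∈ T.aug.ker
        rw [MonoidHom.mem_ker, map_mul, map_inv, hsh, inv_mul_cancel]
      obtain ⟨e, he, t, ht, het⟩ := Subgroup.mem_sup_of_normal_right.mp hy
      have : h = s * (e * t) := by rw [het]; group
      rw [this, hCu]
      refine Subgroup.mul_mem _ ?_ (Subgroup.mul_mem _ ?_ ?_)
      · exact Subgroup.mem_sup_left (Subgroup.mem_sup_left (Subgroup.mem_sup_left hs))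
      · exact Subgroup.mem_sup_left (Subgroup.mem_sup_left (Subgroup.mem_sup_right he))
      · exact Subgroup.mem_sup_right ht
    have hιCu : ι ∈ T.PiCu := by
      rw [hCu]
      exact Subgroup.mem_sup_left (Subgroup.mem_sup_right (Subgroup.mem_zpowers ι))
    intro x hx
    by_cases hxX : x ∈ T.PiX
    · exact hH ⟨hx, hxX⟩
    · have hιinv : ι⁻¹ ∉ T.PiX := fun h => hι.not_mem ((Subgroup.inv_mem_iff _).mp h)
      have hιx : ι⁻¹ * x ∈ T.PiX :=
        (Subgroup.mul_mem_iff_of_index_two T.index_PiX).mpr (iff_of_false hιinv hxX)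
      have hmem : ι⁻¹ * x ∈ T.PiCu := hH ⟨Subgroup.mul_mem _ (Subgroup.inv_mem _ hιH') hx, hιx⟩
      have : x = ι * (ι⁻¹ * x) := by group
      rw [this]
      exact Subgroup.mul_mem _ hιCu hmem

/-- **Remark 2.1.1, normaliser form (profinite)**: `N_{Π_C}(Π_{C̲}) = Π_{C̲}` — from t2's discharged
`CoverDataAx.rmk211_holds` (`N(Π_{C̲}) ∩ Π_X = Π_{X̲}`) and `[Π_C : Π_X] = 2`.
[cite: MochizukiEtTh2009, Rmk 2.1.1 p.36] -/
theorem normalizer_PiCu_eq : Subgroup.normalizer (T.PiCu : Set T.PiC) = T.PiCu := by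
  obtain ⟨H', ι, hH', hι, hCu⟩ := T.PiCu_spec
  rw [hCu]
  refine le_antisymm ?_ Subgroup.le_normalizer
  have key := T.toCoverDataAx.rmk211_holds H' hH'
  intro n hn
  by_cases hnX : n ∈ T.PiX
  · exact (key.le ⟨hn, hnX⟩).1
  · have hιinv : ι⁻¹ ∉ T.PiX := fun h => hι.not_mem ((Subgroup.inv_mem_iff _).mp h)
    have hιn : ι⁻¹ * n ∈ T.PiX :=
      (Subgroup.mul_mem_iff_of_index_two T.index_PiX).mpr (iff_of_false hιinv hnX)
    have hιN : ι⁻¹ ∈ Subgroup.normalizer (H' : Set T.PiC) :=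
      Subgroup.inv_mem _ (Subgroup.le_normalizer hι.mem)
    have h2 : ι⁻¹ * n ∈ H' := (key.le ⟨Subgroup.mul_mem _ hιN hn, hιn⟩).1
    have : n = ι * (ι⁻¹ * n) := by group
    rw [this]
    exact Subgroup.mul_mem _ hι.mem h2

/-- `Π_{C̲}` is open in `Π_C` (it contains the open subgroup `Π_{C̲̲}`, interface field
`TemperedCoverData.isOpen_PiCuu'`; v2: formerly from `CoverData.isOpen_barKer`, GAP-LEDGER G-L2d3-5).
[cite: MochizukiEtTh2009, Def 2.1 p.36] -/
theorem isOpen_PiCu : IsOpen (T.PiCu : Set T.PiC) :=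
  Subgroup.isOpen_mono (by unfold PiCu; exact le_sup_left) T.isOpen_PiCuu'

/-- Density transfer: an element of `Π^tp_C` normalising `Π^tp_{C̲} = Π_{C̲} ∩ Π^tp_C` maps to an element
of `Π_C` normalising `Π_{C̲}` (conjugation is continuous; `Π_{C̲}` is open and closed; `Π^tp_C` is dense).
[cite: MochizukiEtTh2009, Lem 2.17 (ii) p.58] -/
theorem toHat_mem_normalizer_PiCu {m : T.Gtp}
    (hm : m ∈ Subgroup.normalizer ((T.tp T.PiCu : Subgroup T.Gtp) : Set T.Gtp)) :
    T.toHat m ∈ Subgroup.normalizer (T.PiCu : Set T.PiC) := by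
  -- the key one-sided statement, for any normalising `m`
  have key : ∀ {m : T.Gtp}, m ∈ Subgroup.normalizer ((T.tp T.PiCu : Subgroup T.Gtp) : Set T.Gtp) →
      ∀ y ∈ T.PiCu, T.toHat m * y * (T.toHat m)⁻¹ ∈ T.PiCu := by
    intro m hm y hy
    set c := T.toHat m with hc
    have hclosed : IsClosed (T.PiCu : Set T.PiC) := Subgroup.isClosed_of_isOpen _ T.isOpen_PiCu
    have hcont : Continuous fun y : T.PiC => c * y * c⁻¹ :=
      (continuous_const.mul continuous_id).mul continuous_const
    -- the closed set of good points contains `Π_{C̲} ∩ range toHat`, hence its closure `⊇ Π_{C̲}`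
    have hA : IsClosed {y : T.PiC | c * y * c⁻¹ ∈ T.PiCu} := hclosed.preimage hcont
    have hsub : (T.PiCu : Set T.PiC) ∩ Set.range T.toHat ⊆ {y : T.PiC | c * y * c⁻¹ ∈ T.PiCu} := by
      rintro _ ⟨hy, x, rfl⟩
      have hx : x ∈ T.tp T.PiCu := hy
      have := (Subgroup.mem_normalizer_iff.mp hm x).mp hx
      change T.toHat (m * x * m⁻¹) ∈ T.PiCu at this
      simpa [hc, map_mul, map_inv] using this
    have hdr : DenseRange T.toHat := T.isProfiniteCompletion_toHat.denseRange
    have hdense : (T.PiCu : Set T.PiC) ⊆ closure ((T.PiCu : Set T.PiC) ∩ Set.range T.toHat) :=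
      hdr.open_subset_closure_inter T.isOpen_PiCu
    exact hA.closure_subset_iff.mpr hsub (hdense hy)
  rw [Subgroup.mem_normalizer_iff]
  intro y
  constructor
  · exact key hm y
  · intro hy
    have hm' : m⁻¹ ∈ Subgroup.normalizer ((T.tp T.PiCu : Subgroup T.Gtp) : Set T.Gtp) :=
      Subgroup.inv_mem _ hm
    have := key hm' _ hy
    simpa [map_inv, mul_assoc] using this

/-- **`Aut_K(C̲^log) = {1}`** (Remark 2.6.1, `C̲`-clause; Remark 2.1.1): the normaliser quotient
`N_{Π^tp_C}(Π^tp_{C̲})/Π^tp_{C̲}` is trivial — PROVED over the interface, no `μ_l ⊆ K` needed.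
[cite: MochizukiEtTh2009, Rmk 2.6.1 p.40] -/
theorem autK_tpPiCu_subsingleton : Subsingleton (T.autK (T.tp T.PiCu)) := by
  refine ⟨fun a b => ?_⟩
  induction a using QuotientGroup.induction_on with
  | H a =>
    induction b using QuotientGroup.induction_on with
    | H b =>
      rw [QuotientGroup.eq, Subgroup.mem_subgroupOf]
      have hab : ((a⁻¹ * b : ↥(Subgroup.normalizer ((T.tp T.PiCu : Subgroup T.Gtp) : Set T.Gtp))) :
          T.Gtp) ∈ Subgroup.normalizer ((T.tp T.PiCu : Subgroup T.Gtp) : Set T.Gtp) := (a⁻¹ * b).2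
      have h := T.toHat_mem_normalizer_PiCu hab
      rw [T.normalizer_PiCu_eq] at h
      exact h

end TemperedCoverData

end ThetaCovers

end Literature.AnabelianGeometry.EtaleTheta
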